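import Mathlib.Tactic.Linarith
import Mathlib.Tactic.NormNum
import Mathlib.Tactic.Ring
import HarnessLib

/-!
# The (0,1) cell of the ι-window, XXXV (companion C): the product ground `B₁ × B₂`, XXII — THE CORNER VI, ADDENDUM 1: LEMMA TAN and PROPOSITION
# RIB-LINE (report [XXXV] `H2-ZERO-ONE-35.md` §12): arithmetic shadows

Family `hodge`, b2b cell `hweil` (helper of item stmt-HodgeConjecture-2524). Report
`run/shared/lean/b2b/hodge-weil/b2b-hweil-pv1-g47/H2-ZERO-ONE-35.md` ([XXXV]) §12 (ADDENDUM 1). Context: the x-torsion `𝒦` of `𝒪_{W′}(−2S)` has two layers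
`A ⊂ 𝒦`, `𝒦/A = B′ ⊂ B` ([XXXIV] LEMMA TOR); LEMMA TAN identifies `B/B′` with a twist of the image `𝒩′` of the `x̃`-socle in `𝒪_{W′∩S}`. For an S-line whose
structure in `W′` is a RIBBON with conormal quotient `L`: `deg L = 2 − Ω·Γ + c/2 = 4n₃ − 2n′ + 2 + c/2` (`c` the canonical defect, `0` for an isolated
line), the tangency divisor has degree `deg L + 2`, the layer `A = L(−2S)` has degree `deg L − 4` and `h⁰ = deg L − 5`, and `B′ = L(−E)(−S)` has degree
`−4`: the second layer contributes nothing. The type-1 margins for the `n₃ = n′ = 10` cells with `v′ = 0` under «all S-lines isolated ribbons / triples»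
follow. None of the theorems claims geometry. HONEST FRAMING: census work inside the ladder's H2 test ((0,1) cell) on the SPECIAL fourfold `X₀`;
nothing here is a rung; no case of the Hodge conjecture is proved; no statement of [Markman 2025] / [Perry 2026] / [EdGFS 2025] is used.
-/

-- mandated namespace `Summit.HodgeConjecture.HodgeConjecture.…` (Problem = Summit) trips `linter.dupNamespace`; the lakefile disables it
-- tree-wide (weak option), restated here so stand-alone elaboration is warning-free too.
set_option linter.dupNamespace false

namespace Summit.HodgeConjecture.HodgeConjecture.WeilTypeLadder

section ProductGroundTwentyTwoC

/-- **[XXXV] 12.2 (PROPOSITION RIB-LINE, the degrees).** For a ribbon S-line with canonical defect `c′ := c/2 ≥ 0`: `deg L = 2 − 2(n′ − 2n₃) + c′ =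
4n₃ − 2n′ + 2 + c′`; tangency divisor `deg E = deg L + 2`; `B′ = L(−E)(−S)` has degree `deg L − deg E − 2 = −4 < 0`; `A = L(−2S)` has degree `deg L − 4`
and `h⁰(A) = deg L − 5` once `deg L − 4 ≥ 3`. Type 1 (`n′ = 10`), isolated (`c′ = 0`): `n₃ = 10`: `(deg L, deg E, deg A, h⁰(A)) = (22, 24, 18, 17)`;
`n₃ = 9`: `(18, 20, 14, 13)`; `n₃ = 8`: `(14, 16, 10, 9)`; `n₃ = 7`: `(10, 12, 6, 5)`. [`ring` / `omega`] -/
theorem pg22c_ribbon_line :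
    (∀ n' n₃ c' : ℤ, 2 - 2 * (n' - 2 * n₃) + c' = 4 * n₃ - 2 * n' + 2 + c') ∧
    (∀ dL : ℤ, dL - (dL + 2) - 2 = -4) ∧
    (∀ dL : ℤ, 7 ≤ dL → (dL - 4) + 1 - 2 = dL - 5 ∧ 3 ≤ dL - 4) ∧
    ((4 : ℤ) * 10 - 20 + 2 = 22 ∧ (22 : ℤ) + 2 = 24 ∧ (22 : ℤ) - 4 = 18 ∧ (22 : ℤ) - 5 = 17) ∧
    ((4 : ℤ) * 9 - 20 + 2 = 18 ∧ (4 : ℤ) * 8 - 20 + 2 = 14 ∧ (4 : ℤ) * 7 - 20 + 2 = 10) := by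
  refine ⟨fun n' n₃ c' => by ring, fun dL => by ring, fun dL h => ⟨by ring, by omega⟩, by norm_num, by norm_num⟩

/-- **[XXXV] 12.3 (COROLLARY ISO-RIB, the `n₃ = n′ = 10`, `v′ = 0` cells).** With `MAIN = 156`, `h′ = 2f + w ≤ 11` (`f` free pairs, `w ≤ 6` fixed lines),
isolated RIBBON lines cost `≤ 17` invariants per free pair and `≤ (17 + 3)/2 = 10` per fixed line while giving `SOC⁺ = 5f + w`:
`margin ≥ 156 − 17f − 10w + 5f + w = 156 − 12f − 9w ≥ 75 ≥ 2`; isolated TRIPLE structures add `≤ 2n₃ − n′ − 4 = 6` per line-orbit: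
`margin ≥ 156 − 18f − 15w ≥ 27 ≥ 2`. [`omega`] -/
theorem pg22c_iso_margins :
    ((2 : ℤ) * 10 - 10 - 4 = 6) ∧
    (∀ f w : ℤ, 0 ≤ f → 0 ≤ w → w ≤ 6 → 2 * f + w ≤ 11 → 75 ≤ 156 - 17 * f - 10 * w + (5 * f + w) ∧ 2 ≤ 156 - 12 * f - 9 * w) ∧
    (∀ f w : ℤ, 0 ≤ f → 0 ≤ w → w ≤ 6 → 2 * f + w ≤ 11 → 27 ≤ 156 - (17 + 6) * f - (10 + 6) * w + (5 * f + w)) := by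
  refine ⟨by norm_num, fun f w hf hw h6 h => ⟨by omega, by omega⟩, fun f w hf hw h6 h => by omega⟩

/-- **[XXXV] 12.1 (LEMMA TAN, the comparison with [XXXIV]'s charge).** [XXXIV] TOR⁺ charged the two layers `(p₁ − 1) + (p₂ − 1)` sections per line-unit with
`p₁ = a₁ + 2n₃ − 2n′`, `p₂ = p₁ − 2`, i.e. `2a₁ + 4n₃ − 4n′ − 4` (`= 36` at `a₁ = 20`, `n₃ = n′ = 10`), invariant half `a₁ + 2n₃ − 2n′ − 2 = 18`; for an
isolated ribbon line only the first layer survives: `p₂ − 1 = 17` sections, at most `10` invariant for a fixed line — a saving of `8` per fixed line and of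
`19` per free pair (`36 − 17`). [`ring` / `norm_num`] -/
theorem pg22c_tan_saving :
    (∀ a₁ n₃ n' : ℤ, (a₁ + 2 * n₃ - 2 * n' - 1) + (a₁ + 2 * n₃ - 2 * n' - 2 - 1) = 2 * a₁ + 4 * n₃ - 4 * n' - 4) ∧
    ((2 : ℤ) * 20 + 4 * 10 - 4 * 10 - 4 = 36 ∧ (20 : ℤ) + 2 * 10 - 2 * 10 - 2 = 18 ∧ (18 : ℤ) - 10 = 8 ∧ (36 : ℤ) - 17 = 19) := by
  refine ⟨fun a₁ n₃ n' => by ring, by norm_num⟩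

end ProductGroundTwentyTwoC

end Summit.HodgeConjecture.HodgeConjecture.WeilTypeLadder
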